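import Mathlib.AlgebraicGeometry.Morphisms.FiniteType
import Mathlib.AlgebraicGeometry.AffineScheme
import Mathlib.AlgebraicGeometry.ResidueField
import Mathlib.RingTheory.KrullDimension.NonZeroDivisors
import Mathlib.RingTheory.AlgebraicIndependent.Transcendental
import Mathlib.Order.KrullDimension
import Literature.RingTheory.KrullDimension.AffineDimension
import HarnessLib

/-!
# The dimension of the closure of a point of a scheme locally of finite type over a field

For a scheme `Y` and a point `y`, Mathlib orders the points of `Y` by `a ≤ b ↔ b ⤳ a`
(`AlgebraicGeometry.Scheme.le_iff_specializes`), so that `Order.height y` is the Krull dimension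
of the closure `closure {y}` (the supremum of the lengths of chains of irreducible closed subsets
of `closure {y}`), the "dimension of the point `y`" used to grade algebraic cycles
(`Literature.AlgebraicGeometry.Motives.Cycles`, `Literature.AlgebraicGeometry.Motives.cyclesOfDim`). Unlike the codimension
`Order.coheight y = dim 𝒪_{Y,y}` (Mathlib `AlgebraicGeometry.ringKrullDim_stalk_eq_coheight`),
this dimension is not visible in a single affine chart of a general scheme. This file proves the
**chart formula** for schemes locally of finite type over a field `K`
(`Literature.AlgebraicGeometry.Dimension.Scheme.height_eq_ringKrullDim_quotient_primeIdealOf`): for every affine open `U ∋ y`,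

`dim closure {y} = Order.height y = dim Γ(Y, U) ⧸ 𝔭_U(y)`,

where `𝔭_U(y) ⊂ Γ(Y, U)` is the prime ideal of `y` (Mathlib `IsAffineOpen.primeIdealOf`); by
`Literature.RingTheory.KrullDimension.ringKrullDim_eq_trdeg` this is also `trdeg_K κ(y)` (Görtz–Wedhorn I, Thm. 5.22 (1):
`dim X = trdeg_K κ(η)` for `X` irreducible, locally of finite type over `K`, with generic point `η`,
and (3): `dim U = dim X` for non-empty open `U ⊆ X`).

## Proof

* For any scheme and any affine open `U ∋ y`, chains of primes of `Γ(Y, U)` above `𝔭_U(y)` are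
  chains of points of `U ⊆ Y` below `y` (the open immersion `Spec Γ(Y, U) → Y` is an order
  embedding for the specialisation orders), so `coheight 𝔭_U(y) ≤ height y`
  (`Literature.AlgebraicGeometry.Dimension.Scheme.coheight_primeIdealOf_le_height`); conversely a chain of points below `y` lies in any
  affine open `V` containing its bottom, so it is bounded by `coheight 𝔭_V(y)` for *that* `V`
  (`Literature.AlgebraicGeometry.Dimension.Scheme.length_le_coheight_primeIdealOf`).
* For `Y` locally of finite type over a field `K`, `dim Γ(Y, U) ⧸ 𝔭_U(y)` does not depend on the
  affine open `U ∋ y` (`Literature.AlgebraicGeometry.Dimension.Scheme.ringKrullDim_quotient_primeIdealOf_eq`): `Γ(Y, U) ⧸ 𝔭_U(y)` is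
  an affine domain over `K`, so its dimension is its transcendence degree
  (`Literature.RingTheory.KrullDimension.ringKrullDim_eq_trdeg`, Matsumura Thm. 5.6), and it embeds into the residue field `κ(y)`
  through the evaluation map with `κ(y)` algebraic (indeed the fraction field) over the image, so
  its transcendence degree is `trdeg_K κ(y)` by the tower law (Mathlib `Algebra.trdeg_add_eq`).

## Main results

* `Literature.AlgebraicGeometry.Dimension.PrimeSpectrum.coe_coheight_eq_ringKrullDim_quotient`: `coheight 𝔭 = dim R ⧸ 𝔭`.
* `Literature.AlgebraicGeometry.Dimension.Scheme.coheight_primeIdealOf_le_height`, `Literature.AlgebraicGeometry.Dimension.Scheme.length_le_coheight_primeIdealOf`.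
* `Literature.AlgebraicGeometry.Dimension.Scheme.ringKrullDim_quotient_primeIdealOf_eq`: chart independence over a field.
* `Literature.AlgebraicGeometry.Dimension.Scheme.height_eq_ringKrullDim_quotient_primeIdealOf`: the chart formula
  `height y = dim Γ(Y, U) ⧸ 𝔭_U(y)` (Görtz–Wedhorn I, Thm. 5.22).

## References

* U. Görtz, T. Wedhorn, *Algebraic Geometry I: Schemes*, 2nd ed. (2020), Thm. 5.22 and its proof
  (p. 158–159: `trdeg_k κ(x) = dim closure {x}`), Lemma 5.7.
* H. Matsumura, *Commutative Ring Theory* (1986), Thm. 5.6.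
* R. Hartshorne, *Algebraic Geometry* (1977), II Ex. 3.20 (e).
-/

universe u

open CategoryTheory AlgebraicGeometry Order Topology TopologicalSpace

namespace Literature.AlgebraicGeometry.Dimension

/-! ### Coheight of a prime and the dimension of the quotient -/

/-- For a prime `𝔭` of a commutative ring `R`, the coheight of `𝔭` in `Spec R` (supremum of
lengths of chains of primes above `𝔭`) is the Krull dimension of `R ⧸ 𝔭` (both are the Krull
dimension of the poset `V(𝔭) = {𝔮 ⊇ 𝔭}`; Matsumura, *Commutative Ring Theory*, §5,
"`coht 𝔭 = dim R ⧸ 𝔭`"). [cite: Matsumura1987, §5 (definition of coheight)] -/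
theorem PrimeSpectrum.coe_coheight_eq_ringKrullDim_quotient {R : Type*} [CommRing R]
    (p : PrimeSpectrum R) :
    ((coheight p : ℕ∞) : WithBot ℕ∞) = ringKrullDim (R ⧸ p.asIdeal) := by
  rw [coheight_eq_krullDim_Ici, ringKrullDim_quotient]
  refine Order.krullDim_eq_of_orderIso (OrderIso.setCongr _ _ ?_)
  ext q
  simp [PrimeSpectrum.mem_zeroLocus, ← PrimeSpectrum.asIdeal_le_asIdeal, SetLike.coe_subset_coe]

/-! ### Chains below a point versus chains of primes in an affine chart -/

namespace Scheme

variable {Y : Scheme.{u}}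

/-- For an affine open `U` of a scheme `Y`, the open immersion `Spec Γ(Y, U) → Y` reflects and
preserves specialisation: for primes `𝔮, 𝔮'` of `Γ(Y, U)` one has `𝔮 ≤ 𝔮'` iff the point of
`𝔮` specialises to the point of `𝔮'` in `Y`. [folklore] -/
lemma fromSpec_specializes_iff {U : Y.Opens} (hU : IsAffineOpen U)
    (q q' : PrimeSpectrum Γ(Y, U)) : hU.fromSpec q ⤳ hU.fromSpec q' ↔ q ≤ q' := by
  rw [hU.fromSpec.isOpenEmbedding.isInducing.specializes_iff, PrimeSpectrum.le_iff_specializes]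
  exact Iff.rfl

/-- For `y` in an affine open `U` and `a ∈ U`, `y ⤳ a` iff `𝔭_U(y) ≤ 𝔭_U(a)`. [folklore] -/
lemma specializes_iff_primeIdealOf_le {U : Y.Opens} (hU : IsAffineOpen U) (a b : U) :
    (a : Y) ⤳ (b : Y) ↔ hU.primeIdealOf a ≤ hU.primeIdealOf b := by
  rw [← fromSpec_specializes_iff hU, hU.fromSpec_primeIdealOf, hU.fromSpec_primeIdealOf]

/-- **Chains of primes above `𝔭_U(y)` are chains of points below `y`.** For any scheme `Y`, any
affine open `U ∋ y`: `coheight 𝔭_U(y) ≤ height y`, i.e. `dim Γ(Y, U) ⧸ 𝔭_U(y) ≤ dim closure {y}`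
(the open immersion `Spec Γ(Y, U) → Y` is a strictly monotone map from `Spec Γ(Y, U)` with the
reversed inclusion order to `Y` with `a ≤ b ↔ b ⤳ a`; Görtz–Wedhorn I, Lemma 5.7 (2), proof).
[cite: GortzWedhorn2020, Lemma 5.7] -/
theorem coheight_primeIdealOf_le_height {U : Y.Opens} (hU : IsAffineOpen U) {y : Y} (hy : y ∈ U) :
    coheight (hU.primeIdealOf ⟨y, hy⟩) ≤ height y := by
  let g : (PrimeSpectrum Γ(Y, U))ᵒᵈ → Y := fun q ↦ hU.fromSpec (OrderDual.ofDual q)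
  have hg : StrictMono g := by
    intro q₁ q₂ hlt
    have hle : OrderDual.ofDual q₂ ≤ OrderDual.ofDual q₁ := OrderDual.ofDual_le_ofDual.mpr hlt.le
    refine lt_iff_le_not_ge.mpr ⟨?_, fun h ↦ hlt.not_ge ?_⟩
    · exact AlgebraicGeometry.Scheme.le_iff_specializes.mpr
        ((fromSpec_specializes_iff hU _ _).mpr hle)
    · exact OrderDual.ofDual_le_ofDual.mp ((fromSpec_specializes_iff hU _ _).mp
        (AlgebraicGeometry.Scheme.le_iff_specializes.mp h))
  have h : coheight (hU.primeIdealOf ⟨y, hy⟩) ≤ height (hU.fromSpec (hU.primeIdealOf ⟨y, hy⟩)) :=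
    height_le_height_apply_of_strictMono g hg (OrderDual.toDual (hU.primeIdealOf ⟨y, hy⟩))
  rwa [hU.fromSpec_primeIdealOf] at h

/-- **Chains of points below `y` are chains of primes in any chart containing their bottom.** For
any scheme `Y`, a chain `p₀ < p₁ < ⋯ < pₙ = y` of points (i.e. `y ⤳ ⋯ ⤳ p₀`) and an affine
open `V` containing `p₀` (hence every `pᵢ` and `y`): `n ≤ coheight 𝔭_V(y)`
(Görtz–Wedhorn I, proof of Lemma 5.7 (2) and of Prop. 5.26). [cite: GortzWedhorn2020, Lemma 5.7] -/
theorem length_le_coheight_primeIdealOf {V : Y.Opens} (hV : IsAffineOpen V) (p : LTSeries Y)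
    (h₀ : p.head ∈ V) (hlast : p.last ∈ V) :
    p.length ≤ coheight (hV.primeIdealOf ⟨p.last, hlast⟩) := by
  have hmem : ∀ i, p i ∈ V := fun i ↦
    (AlgebraicGeometry.Scheme.le_iff_specializes.mp (p.head_le i)).mem_open V.2 h₀
  -- the chain of primes, in the order dual of `PrimeSpectrum Γ(Y, V)`
  let q : LTSeries (PrimeSpectrum Γ(Y, V))ᵒᵈ :=
    LTSeries.mk p.length (fun i ↦ OrderDual.toDual (hV.primeIdealOf ⟨p i, hmem i⟩)) (by
      intro i j hij
      have hlt : p i < p j := p.strictMono hij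
      change hV.primeIdealOf ⟨p j, hmem j⟩ < hV.primeIdealOf ⟨p i, hmem i⟩
      refine lt_of_le_of_ne ?_ ?_
      · exact (specializes_iff_primeIdealOf_le hV ⟨p j, hmem j⟩ ⟨p i, hmem i⟩).mp
          (AlgebraicGeometry.Scheme.le_iff_specializes.mp hlt.le)
      · intro h
        have : (p i : Y) ⤳ p j :=
          (specializes_iff_primeIdealOf_le hV ⟨p i, hmem i⟩ ⟨p j, hmem j⟩).mpr h.symm.le
        exact hlt.not_ge (AlgebraicGeometry.Scheme.le_iff_specializes.mpr this))
  exact Order.length_le_height_last (p := q)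

end Scheme

/-! ### Chart independence over a field -/

section Field

variable {K : Type u} [Field K] {Y : Scheme.{u}} (f : Y ⟶ Spec (CommRingCat.of K))

namespace Scheme

/-- **The dimension of `Γ(Y, U) ⧸ 𝔭_U(y)` does not depend on the affine chart `U ∋ y`** for `Y`
locally of finite type over a field `K`: it is the transcendence degree of the residue field
`κ(y)` over `K` (Görtz–Wedhorn I, Thm. 5.22 (1) and its proof: `Γ(Y, U) ⧸ 𝔭_U(y)` is an affine
domain with `dim = trdeg_K` (Matsumura Thm. 5.6), embedded into `κ(y)` by evaluation with `κ(y)`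
algebraic over the image, and transcendence degree is additive in towers).
[cite: GortzWedhorn2020, Thm. 5.22 (1)] -/
theorem ringKrullDim_quotient_primeIdealOf_eq [LocallyOfFiniteType f] {U V : Y.Opens}
    (hU : IsAffineOpen U) (hV : IsAffineOpen V) {y : Y} (hyU : y ∈ U) (hyV : y ∈ V) :
    ringKrullDim (Γ(Y, U) ⧸ (hU.primeIdealOf ⟨y, hyU⟩).asIdeal) =
      ringKrullDim (Γ(Y, V) ⧸ (hV.primeIdealOf ⟨y, hyV⟩).asIdeal) := by
  classical
  -- the `K`-algebra structure on the residue field `κ(y)`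
  let ι : K →+* Γ(Spec (CommRingCat.of K), ⊤) := (Scheme.ΓSpecIso (CommRingCat.of K)).inv.hom
  let φκ : K →+* Y.residueField y := (Y.Γevaluation y).hom.comp (f.appTop.hom.comp ι)
  letI algκ : Algebra K (Y.residueField y) := φκ.toAlgebra
  -- for every affine chart `W ∋ y`: `dim Γ(W) ⧸ 𝔭_W(y) = trdeg_K κ(y)`
  suffices key : ∀ {W : Y.Opens} (hW : IsAffineOpen W) (hyW : y ∈ W),
      ringKrullDim (Γ(Y, W) ⧸ (hW.primeIdealOf ⟨y, hyW⟩).asIdeal) =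
        (Cardinal.toNat (Algebra.trdeg K (Y.residueField y)) : WithBot ℕ∞) by
    rw [key hU hyU, key hV hyV]
  intro W hW hyW
  set 𝔭 := hW.primeIdealOf ⟨y, hyW⟩ with h𝔭def
  -- `K`-algebra structure on `Γ(Y, W)` and the evaluation map `ψ : Γ(Y, W) → κ(y)`
  let φW : K →+* Γ(Y, W) := (f.appLE ⊤ W le_top).hom.comp ι
  letI algW : Algebra K Γ(Y, W) := φW.toAlgebra
  let ψ : Γ(Y, W) →+* Y.residueField y := (Y.evaluation W y hyW).hom
  have hψφ : ψ.comp φW = φκ := by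
    have h1 : f.appLE ⊤ W le_top ≫ Y.evaluation W y hyW = f.appTop ≫ Y.Γevaluation y := by
      rw [Scheme.Hom.appLE, Category.assoc]
      congr 1
      change Y.presheaf.map (homOfLE le_top).op ≫ Y.presheaf.germ W y hyW ≫ Y.residue y =
        Y.presheaf.germ ⊤ y trivial ≫ Y.residue y
      rw [← Category.assoc, TopCat.Presheaf.germ_res]
    change ((f.appLE ⊤ W le_top ≫ Y.evaluation W y hyW).hom).comp ι =
      ((f.appTop ≫ Y.Γevaluation y).hom).comp ι
    rw [h1]
  -- finite type
  haveI : Algebra.FiniteType K Γ(Y, W) := by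
    have h1 : (f.appLE ⊤ W le_top).hom.FiniteType :=
      f.finiteType_appLE (isAffineOpen_top _) hW le_top
    have h2 : ι.FiniteType :=
      RingHom.FiniteType.of_surjective _
        (Scheme.ΓSpecIso (CommRingCat.of K)).symm.commRingCatIsoToRingEquiv.surjective
    exact h1.comp h2
  -- the kernel of `ψ` is `𝔭`
  have hker : ∀ a : Γ(Y, W), ψ a = 0 ↔ a ∈ 𝔭.asIdeal := by
    intro a
    have h𝔭 : 𝔭.asIdeal = Ideal.comap (Y.presheaf.germ W y hyW).hom
        (IsLocalRing.maximalIdeal (Y.presheaf.stalk y)) := by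
      rw [h𝔭def, hW.primeIdealOf_eq_map_closedPoint ⟨y, hyW⟩]
      rfl
    rw [h𝔭, Ideal.mem_comap, ← IsLocalRing.residue_eq_zero_iff]
    rfl
  -- every element of `κ(y)` is a fraction `ψ a / ψ s` with `s ∉ 𝔭`
  have hfrac : ∀ c : Y.residueField y, ∃ a s : Γ(Y, W), s ∉ 𝔭.asIdeal ∧ ψ s * c = ψ a := by
    intro c
    letI : Algebra Γ(Y, W) (Y.presheaf.stalk y) :=
      TopCat.Presheaf.algebra_section_stalk Y.presheaf (⟨y, hyW⟩ : W)
    haveI : IsLocalization.AtPrime (Y.presheaf.stalk y) 𝔭.asIdeal := hW.isLocalization_stalk ⟨y, hyW⟩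
    obtain ⟨z, rfl⟩ := Y.residue_surjective y c
    obtain ⟨⟨a, s⟩, rfl⟩ := IsLocalization.mk'_surjective 𝔭.asIdeal.primeCompl z
    refine ⟨a, s, s.2, ?_⟩
    have hs : IsLocalization.mk' (Y.presheaf.stalk y) a s *
        algebraMap Γ(Y, W) (Y.presheaf.stalk y) s = algebraMap Γ(Y, W) (Y.presheaf.stalk y) a :=
      IsLocalization.mk'_spec _ a s
    have h2 := congrArg (Y.residue y).hom hs
    rw [map_mul, mul_comm] at h2
    exact h2
  -- the affine domain `A = Γ(Y, W) ⧸ 𝔭` embeds into `κ(y)`, which is algebraic over it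
  let A := Γ(Y, W) ⧸ 𝔭.asIdeal
  haveI : IsDomain A := Ideal.Quotient.isDomain _
  let lift : A →+* Y.residueField y :=
    Ideal.Quotient.lift 𝔭.asIdeal ψ fun a ha ↦ (hker a).mpr ha
  have hlift_inj : Function.Injective lift :=
    RingHom.lift_injective_of_ker_le_ideal _ _ fun a ha ↦ (hker a).mp ha
  have hliftmk : ∀ a : Γ(Y, W), lift (Ideal.Quotient.mk 𝔭.asIdeal a) = ψ a := fun a ↦
    Ideal.Quotient.lift_mk _ _ _
  letI algA : Algebra A (Y.residueField y) := lift.toAlgebra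
  haveI : IsScalarTower K A (Y.residueField y) := by
    refine IsScalarTower.of_algebraMap_eq fun x ↦ ?_
    change φκ x = lift (Ideal.Quotient.mk _ (φW x))
    rw [← hψφ]
    rfl
  haveI : FaithfulSMul K A := (faithfulSMul_iff_algebraMap_injective K A).mpr
    (algebraMap K A).injective
  haveI : FaithfulSMul A (Y.residueField y) :=
    (faithfulSMul_iff_algebraMap_injective A _).mpr hlift_inj
  haveI : Algebra.IsAlgebraic A (Y.residueField y) := by
    refine ⟨fun c ↦ ?_⟩
    obtain ⟨a, s, hs, hc⟩ := hfrac c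
    have hs' : (Ideal.Quotient.mk 𝔭.asIdeal s : A) ≠ 0 := by
      rwa [Ne, Ideal.Quotient.eq_zero_iff_mem]
    refine ⟨Polynomial.C (Ideal.Quotient.mk 𝔭.asIdeal s) * Polynomial.X -
      Polynomial.C (Ideal.Quotient.mk 𝔭.asIdeal a), fun h ↦ hs' ?_, ?_⟩
    · have := congrArg (fun q ↦ Polynomial.coeff q 1) h
      simpa using this
    · simp only [map_sub, map_mul, Polynomial.aeval_C, Polynomial.aeval_X]
      change lift (Ideal.Quotient.mk _ s) * c - lift (Ideal.Quotient.mk _ a) = 0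
      rw [hliftmk, hliftmk, hc, sub_self]
  -- transcendence degrees: `trdeg_K A = trdeg_K κ(y)`
  have htr : Algebra.trdeg K A = Algebra.trdeg K (Y.residueField y) := by
    rw [← trdeg_add_eq K A (A := Y.residueField y), trdeg_eq_zero (R := A), add_zero]
  rw [Literature.RingTheory.KrullDimension.ringKrullDim_eq_trdeg K A, htr]

/-- **Chart formula for the dimension of a point** (Görtz–Wedhorn I, Thm. 5.22 (1) with (3);
Hartshorne II Ex. 3.20 (e)). For `Y` locally of finite type over a field `K`, `y ∈ Y` and any
affine open `U ∋ y`: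
`Order.height y = dim Γ(Y, U) ⧸ 𝔭_U(y)`,
i.e. the Krull dimension of `closure {y}` (in the order `a ≤ b ↔ b ⤳ a` of Mathlib's schemes) is
computed in any affine chart, where it is the dimension of the affine domain `Γ(Y, U) ⧸ 𝔭_U(y)`
(`= trdeg_K κ(y)`, `Literature.RingTheory.KrullDimension.ringKrullDim_eq_trdeg`). Chains below `y` with bottom in an affine open `V`
are bounded by `coheight 𝔭_V(y)` (`length_le_coheight_primeIdealOf`), which agrees with
`coheight 𝔭_U(y)` by chart independence (`ringKrullDim_quotient_primeIdealOf_eq`).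
[cite: GortzWedhorn2020, Thm. 5.22] [cite: Hartshorne1977, II Ex. 3.20] -/
theorem height_eq_ringKrullDim_quotient_primeIdealOf [LocallyOfFiniteType f] {U : Y.Opens}
    (hU : IsAffineOpen U) {y : Y} (hyU : y ∈ U) :
    ((height y : ℕ∞) : WithBot ℕ∞) = ringKrullDim (Γ(Y, U) ⧸ (hU.primeIdealOf ⟨y, hyU⟩).asIdeal) := by
  rw [← PrimeSpectrum.coe_coheight_eq_ringKrullDim_quotient]
  congr 1
  refine le_antisymm ?_ (coheight_primeIdealOf_le_height hU hyU)
  refine Order.height_le fun p hp ↦ ?_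
  -- an affine open containing the bottom of the chain
  obtain ⟨_, ⟨V, hV, rfl⟩, h₀, -⟩ :=
    Y.isBasis_affineOpens.exists_subset_of_mem_open (Set.mem_univ p.head) isOpen_univ
  have hyV : y ∈ V :=
    hp ▸ (AlgebraicGeometry.Scheme.le_iff_specializes.mp p.head_le_last).mem_open V.2 h₀
  have h1 := length_le_coheight_primeIdealOf hV p h₀ (hp ▸ hyV)
  have h2 : coheight (hV.primeIdealOf ⟨p.last, hp ▸ hyV⟩) = coheight (hV.primeIdealOf ⟨y, hyV⟩) := by
    congr 2
    exact Subtype.ext hp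
  have h3 : coheight (hV.primeIdealOf ⟨y, hyV⟩) = coheight (hU.primeIdealOf ⟨y, hyU⟩) := by
    have := ringKrullDim_quotient_primeIdealOf_eq f hV hU hyV hyU
    rw [← PrimeSpectrum.coe_coheight_eq_ringKrullDim_quotient,
      ← PrimeSpectrum.coe_coheight_eq_ringKrullDim_quotient] at this
    exact_mod_cast this
  rw [h2, h3] at h1
  exact h1

end Scheme

end Field

end Literature.AlgebraicGeometry.Dimension
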